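import Summits.BirchSwinnertonDyer.Rank1Residual.GaloisImage.HauptmodulNineTowerSeven
import Summits.BirchSwinnertonDyer.Rank1Residual.GaloisImage.HauptmodulNineValuationThreeTwo
import HarnessLib

/-!
# The `3`-adic tower at `v₃(j) = 3`, `j/27 ≡ 2 (mod 9)`: `ρ̄_{E,3}` onto implies `ρ̄_{E,3ⁿ}` onto for
# every `n` — the `j/27 ≡ 2` twin of `HauptmodulNineTowerThree` (cell `b2b-bsdres`, team n1011,
# seat p02 gen 6 — row T-b11-F4-END, file F4c-H24)

HONEST FRAMING (cell `b2b-bsdres`, run/shared/lean/b2b/bsd-rank1-residual/, verbatim in every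
file): the goal of the cell is to DELETE the COMBINATION-SHAPED residual classes of the
Birch–Swinnerton-Dyer formula for ALL analytic-rank `≤ 1` elliptic curves over `ℚ` — "full BSD
formula for every rank `≤ 1` curve in class `C`" assembled STRICTLY from published theorems — so
that the rank-`≤ 1` remainder becomes exactly the CONSTRUCTION-SHAPED classes, which are TYPED
(missing-input `Prop`s), NOT attempted. This is not "finishing BSD". Team n1011 (N10 / N11):
research route; no claim beyond the stated classes; labels UNCHANGED; nothing is booked. Theorems
only (no definition, no named fact).

## What this file proves

* `padicValRat_j_sub_1728_of_nine_dvd_num_two` — `9 ∣ num(j/27 − 2)` ⟹ `v₃(j − 1728) = 3`.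
* `exists_nineTorsion_hauptmodulNine_of_padicValRat_j_sub` — the common curve side at
  `v₃(j − 1728) = 3`: a `9`-torsion `Q` over a non-canonical `3`-torsion group and the
  `Stab(ℤQ)`-invariant `θ = η(E, ℤQ) + 3` with `j(θ³ − 27) = θ³(θ³ − 24)³`, `v(θ³) = v(3)`.
* **`towerSurj_three_of_surj_of_nine_dvd_num_two`** — for `E/ℚ` with `ρ̄_{E,3}` onto and
  `9 ∣ num(j/27 − 2)`: `ρ̄_{E,3ⁿ}` is onto for every `n`.  Invariant `z = (3θ/(θ³ − 3))² − 1` of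
  valuation `1/9` (`HauptmodulNineValuationThreeTwo`), criterion with `(d, a, b) = (9, 0, 1)`.
* `imageContainsSL2_three_of_surj_of_nine_dvd_num_two` — Kato's (12.5.2) at `p = 3`.

At `v₃(j) = 3` the `m = 3` core has `j/27 mod 9 ∈ {2, 5, 8}`; `5` = `HauptmodulNineTowerThree`
(84 cells), `2` = this file (no census cell; EVIDENCE kit j137075 on synthetic `j`), `8` = the
'tame' class (27 cells; no prime of `ℚ(θ)` over `3` with `9 ∣ ef` — NOT claimed).  Nothing booked;
no label change.

References: [Maier2006] Table 4 (N = 3, 9), §5; [SerreAbelianLadic1968] IV-23;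
[SerreLocalFields1979] Ch. I §7; [Kato2004Asterisque] (12.5.2).
-/

noncomputable section

set_option maxRecDepth 10000

open scoped Classical

open WeierstrassCurve Field

namespace Summit.BirchSwinnertonDyer.Rank1Residual.GaloisImage

open Literature.NumberTheory.EllipticCurves Literature.NumberTheory.GaloisRepresentations
  Rat.HeightOneSpectrum

variable (W : WeierstrassCurve ℚ) [W.IsElliptic]

/-- `9 ∣ num(j/27 − 2) ⟹ v₃(j − 1728) = 3`: `j − 1728 = 27·((j/27 − 2) − 62)` with
`v₃((j/27 − 2) − 62) = 0`. [folklore] -/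
theorem padicValRat_j_sub_1728_of_nine_dvd_num_two (hj2 : (9 : ℤ) ∣ (W.j / 27 - 2).num) :
    padicValRat 3 (W.j - 1728) = ((3 : ℕ) : ℤ) := by
  haveI : Fact (Nat.Prime 3) := ⟨Nat.prime_three⟩
  have h62 : padicValRat 3 (-62 : ℚ) = 0 := by
    rw [padicValRat.neg, show (62 : ℚ) = ((62 : ℕ) : ℚ) by norm_num, padicValRat.of_nat,
      padicValNat.eq_zero_of_not_dvd (by norm_num)]
    rfl
  have hne' : -62 + (W.j / 27 - 2) ≠ 0 := by
    intro h0
    have e62 : W.j / 27 - 2 = 62 := by linear_combination h0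
    have h2 : (9 : ℤ) ∣ (62 : ℚ).num := by rw [← e62]; exact hj2
    norm_num at h2
  have hr : padicValRat 3 (-62 + (W.j / 27 - 2)) = 0 := by
    by_cases hq : W.j / 27 - 2 = 0
    · rw [hq, add_zero, h62]
    have h2 := two_le_padicValRat_of_nine_dvd_num hq hj2
    rw [padicValRat.add_eq_min hne' (by norm_num) hq (by rw [h62]; omega), h62]
    exact min_eq_left (by omega)
  have e : W.j - 1728 = 27 * (-62 + (W.j / 27 - 2)) := by ring
  have h27 : padicValRat 3 (27 : ℚ) = 3 := by
    have h33 : padicValRat 3 (3 : ℚ) = 1 := by exact_mod_cast padicValRat.self (p := 3) (by norm_num)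
    rw [show (27 : ℚ) = 3 ^ 3 by norm_num, padicValRat.pow, h33]
    all_goals norm_num
  rw [e, padicValRat.mul (by norm_num) hne', h27, hr]
  rfl

/-- The common curve side at `v₃(j − 1728) = 3`: a `9`-torsion point `Q` over a non-canonical
`3`-torsion group and the `Stab(ℤQ)`-invariant `θ = η(E, ℤQ) + 3 ∈ ℚ(E[9])` with
`j(θ³ − 27) = θ³(θ³ − 24)³` and `v(θ³) = v(3)`. [cite: Maier2006, Table 4 (N = 9) and §5] -/
theorem exists_nineTorsion_hauptmodulNine_of_padicValRat_j_sub
    (hj3 : padicValRat 3 (W.j - 1728) = ((3 : ℕ) : ℤ)) :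
    ∃ (Q : W.geomPoints) (θ : AlgebraicClosure ℚ), Q ∈ geomTorsion W 9 ∧ θ ∈ W.divisionField 9 ∧
      (∀ σ : absoluteGaloisGroup ℚ, (∃ c : ℤ, σ • Q = c • Q) → σ • θ = θ) ∧
      algebraMap ℚ (AlgebraicClosure ℚ) W.j * (θ ^ 3 - 27) = θ ^ 3 * (θ ^ 3 - 24) ^ 3 ∧
      (placeOver 3).valuation (θ ^ 3) = (placeOver 3).valuation (3 : AlgebraicClosure ℚ) := by
  haveI : Fact (Nat.Prime 3) := ⟨Nat.prime_three⟩
  obtain ⟨Q, x₃, y₃, h₃, hQ9, hQ3, -, hvalS⟩ :=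
    exists_nineTorsion_hauptmodul_three_valuation W (m := 3) (by norm_num) (by norm_num) hj3
  have h3Q : (3 ^ 1 : ℕ) • Q ≠ 0 := by
    rw [pow_one, ← natCast_zsmul, Nat.cast_ofNat, hQ3]
    exact Affine.Point.some_ne_zero h₃
  have h9Q : (3 ^ (1 + 1) : ℕ) • Q = 0 := by
    rw [← natCast_zsmul]; exact_mod_cast hQ9
  have h9 : addOrderOf Q = 9 := by
    have := addOrderOf_eq_prime_pow h3Q h9Q
    norm_num at this
    exact this
  obtain ⟨θ, hθL, hθfix, hjθ, hSθ⟩ := exists_hauptmodulNine_invariant W h9 hQ3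
  have hSθ' : (W.map (algebraMap ℚ (AlgebraicClosure ℚ))).tgA₁ x₃ y₃ ^ 3 /
      (W.map (algebraMap ℚ (AlgebraicClosure ℚ))).tgA₃ x₃ y₃ = θ ^ 3 := hSθ
  rw [hSθ'] at hvalS
  have hvS : (placeOver 3).valuation (θ ^ 3) = (placeOver 3).valuation (3 : AlgebraicClosure ℚ) :=
    (pow_left_inj₀ zero_le zero_le three_ne_zero).mp hvalS
  exact ⟨Q, θ, (Submodule.mem_torsionBy_iff _ _).mpr hQ9, hθL, hθfix, hjθ, hvS⟩

/-- **THE TOWER AT `j/27 ≡ 2 (mod 9)`.**  For `E/ℚ` with `ρ̄_{E,3}` onto and `9 ∣ num(j/27 − 2)`,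
`ρ̄_{E,3ⁿ}` is onto for every `n` (level-`9` Hauptmodul: the `Stab(ℤQ)`-invariant
`z = (3θ/(θ³ − 3))² − 1 ∈ ℚ(E[9])`, `θ = η(E, ℤQ) + 3`, has `3`-adic valuation exactly `1/9`;
scalar-stabiliser tower criterion). [cite: SerreAbelianLadic1968, Ch. IV §3.4, Lemma 3 (IV-23)]
[cite: Maier2006, Table 4 (N = 9) and §5] -/
theorem towerSurj_three_of_surj_of_nine_dvd_num_two (hsurj : W.HasSurjectiveModNGaloisRep 3)
    (hj2 : (9 : ℤ) ∣ (W.j / 27 - 2).num) (n : ℕ) : W.HasSurjectiveModNGaloisRep (3 ^ n : ℕ) := by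
  haveI : Fact (Nat.Prime 3) := ⟨Nat.prime_three⟩
  set v := (placeOver 3).valuation with hv
  set t := v (3 : AlgebraicClosure ℚ) with ht
  have ht0 : t ≠ 0 := valuation_three_ne_zero
  have hj3 := padicValRat_j_sub_1728_of_nine_dvd_num_two W hj2
  obtain ⟨Q, θ, hQ₉, hθL, hθfix, hjθ, hvS⟩ := exists_nineTorsion_hauptmodulNine_of_padicValRat_j_sub W hj3
  -- the curve-free core: `v(z)⁹ = t`
  have hz := valuation_hauptmodul_nine_invariant_three_two_pow_nine hj2 hjθ hvS rfl
  have hz0 : (3 * θ / (θ ^ 3 - 3)) ^ 2 - 1 ≠ 0 := by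
    intro h0
    rw [h0, map_zero, zero_pow (by norm_num)] at hz
    exact ht0 hz.symm
  have hzL : (3 * θ / (θ ^ 3 - 3)) ^ 2 - 1 ∈ W.divisionField 9 :=
    sub_mem (pow_mem (div_mem (mul_mem (ofNat_mem _ 3) hθL)
      (sub_mem (pow_mem hθL 3) (ofNat_mem _ 3))) 2) (one_mem _)
  have hfix : ∀ σ : absoluteGaloisGroup ℚ, (∃ c : ℤ, σ • Q = c • Q) →
      σ • ((3 * θ / (θ ^ 3 - 3)) ^ 2 - 1) = (3 * θ / (θ ^ 3 - 3)) ^ 2 - 1 := by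
    intro σ hσ
    have hθ' : absoluteGaloisGroup.toAlgEquiv ℚ σ θ = θ := by
      rw [← absoluteGaloisGroup.smul_def]; exact hθfix σ hσ
    rw [absoluteGaloisGroup.smul_def]
    simp only [map_sub, map_div₀, map_mul, map_pow, map_ofNat, map_one, hθ']
  -- the scalar-stabiliser tower criterion with `d = 9`, `a = 0`, `b = 1`
  have hval : v ((3 * θ / (θ ^ 3 - 3)) ^ 2 - 1) ^ 9 * t ^ 0 = t ^ 1 := by
    rw [pow_zero, mul_one, pow_one]; exact hz
  have hcop : IsCoprime ((9 : ℕ) : ℤ) (((0 : ℕ) : ℤ) - ((1 : ℕ) : ℤ)) := ⟨0, -1, by norm_num⟩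
  exact towerSurj_three_of_surj_of_valuation_of_smul_zmultiples W hsurj hQ₉ hzL hz0 hfix hval hcop
    (dvd_refl 9) n

/-- **Kato's (12.5.2) at `p = 3` on the family `v₃(j) = 3`, `j/27 ≡ 2 (mod 9)`** from surj(3).
[cite: Kato2004Asterisque, (12.5.2) (p. 222)] [cite: SerreAbelianLadic1968, Ch. IV §3.4, Lemma 3 (IV-23)] -/
theorem imageContainsSL2_three_of_surj_of_nine_dvd_num_two
    (hsurj : W.HasSurjectiveModNGaloisRep 3) (hj2 : (9 : ℤ) ∣ (W.j / 27 - 2).num) :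
    Kato2004.ImageContainsSL2 W 3 := by
  haveI : Fact (Nat.Prime 3) := ⟨Nat.prime_three⟩
  exact (Kato2004.imageContainsSL2_iff_forall_hasSurjectiveModNGaloisRep W 3).mpr
    (towerSurj_three_of_surj_of_nine_dvd_num_two W hsurj hj2)

end Summit.BirchSwinnertonDyer.Rank1Residual.GaloisImage
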